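import Summits.CriticalPhenomena.SAWScalingLimit.Theorems.SAWTensorRGRestrictionOfLimitStubLatticeRestriction
import Summits.CriticalPhenomena.SAWScalingLimit.Theorems.SAWTensorRGRestrictionOfLimitStubInteriorAvoidance

/-!
# Generic restriction: LSW's restriction identity for a full SAW scaling limit holds off a countable set

Support file (`--supports stmt-CriticalPhenomena-0773`, registered stub `stub_restrictionOffCountable`) of the line
`birth` for the crux `RestrictionOfLimit` (shared verbatim by the routes SAWConePseudogroup / SAWConfRestriction /
SAWBrownianDomination / SAWTowerCount / SAWTensorRG). With S1 (`stub_latticeRestriction`), S2 (`stub_domination`)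
and S3b (`stub_interiorAvoidance`) in the tree, the crux for a pair `D' ⊆ D` (same marked points) is reduced to ONE
null set, `P D ({γ ⊆ cl D'} ∩ {range γ ∩ closure (D ∖ D') ≠ ∅}) = 0` (null touching). This file proves:

* `restriction_pair_of_noAvoidanceLoss` — the skeleton's `ℝ≥0∞` squeeze, LOCALISED to one pair and one endpoint
  approximation: S3 for the pair ⇒ `P D'(T) · P D {γ ⊆ cl D'} = P D (T ∩ {γ ⊆ cl D'})` for all Borel `T`.
* `restriction_pair_of_nullTouch` — null touching for the pair ⇒ the restriction identity for the pair.
* `countable_setOf_touch_pos` — for any family `E i` of sub-domains that is SEPARATED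
  (`cl (E i) ∩ cl (D ∖ E j) = ∅` one way or the other for `i ≠ j`; e.g. `D` minus closed discs of distinct radii about
  a boundary point off `a`, `b`), the touching events are pairwise disjoint closed sets, so only countably many of them
  have positive `P D`-mass (`Measure.countable_meas_pos_of_disjoint_iUnion`).
* `stub_restrictionOffCountable` — **GENERIC RESTRICTION**: for every full scaling-limit family `P`, Dobrushin `D` and
  separated family `E : ι → DobrushinDomain` of sub-domains of `D` with the same marked points, there is a countable
  `S ⊆ ι` off which the restriction identity holds for every Borel `T`. So the crux can only fail on a countable
  exceptional set of sub-domains in each separated family; its remaining content (`stub_nullTouchHull`) is exactly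
  "the given `D'` is not exceptional".

References: G. F. Lawler, O. Schramm, W. Werner, *On the scaling limit of planar self-avoiding walk* (2004), §3.4.5;
*Conformal restriction: the chordal case* (2003), §2–3. No named fact; axioms `propext`, `Classical.choice`,
`Quot.sound`.
-/

noncomputable section

open MeasureTheory Filter Topology Set Metric
open Literature.Probability.RandomPlanarGeometry Literature.Probability.LatticeModels
open scoped ENNReal NNReal

namespace Summit.CriticalPhenomena.SAWScalingLimit.Theorems.RestrictionOfLimit.Birth

variable {P : ChordalFamily}

/-! ### The squeeze, localised to one pair of domains -/

/-- An `ℝ≥0∞` squeeze: if `a ≤ A`, `b ≤ B`, the sums agree and `b` is finite, then `a = A`. [folklore] -/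
theorem eq_of_le_of_add_eq_add {a A b B : ℝ≥0∞} (ha : a ≤ A) (hb : b ≤ B) (hs : a + b = A + B)
    (hbt : b ≠ ∞) : a = A := by
  refine le_antisymm ha ?_
  have h : A + b ≤ a + b := by
    calc A + b ≤ A + B := add_le_add le_rfl hb
      _ = a + b := hs.symm
  exact (ENNReal.add_le_add_iff_right hbt).1 h

/-- **The restriction identity for ONE pair from no-loss-of-avoidance-mass for that pair** (the skeleton's
squeeze `RestrictionOfLimit_of`, localised): if `P` is a full scaling-limit family, `D' ⊆ D` have the same marked
points, `(a_δ, b_δ)` is an endpoint approximation of `D'` and `P D {γ ⊆ cl D'} ≤ c := liminf_{δ→0⁺} P_{D,δ}[the walk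
is a walk of D'_δ]` (S3 for the pair), then `P D'(T) · P D {γ ⊆ cl D'} = P D (T ∩ {γ ⊆ cl D'})` for every Borel `T`.
S2 (landed, fed S1) at `univ` and the hypothesis give `c = P D {γ ⊆ cl D'}`; S2 at `T` and `Tᶜ`, whose sides both
sum to `c`, forces termwise equality by finiteness. [folklore] -/
theorem restriction_pair_of_noAvoidanceLoss (hP : SAW.IsScalingLimitFamily P) {D D' : DobrushinDomain}
    (hsub : D'.carrier ⊆ D.carrier) (h0 : D'.pt 0 = D.pt 0) (h1 : D'.pt 1 = D.pt 1)
    {a b : ℝ → Site 2} (hab : SAW.IsEndpointApprox D' a b)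
    (hN : P D (CurveClass.rangeSubset (closure D'.carrier)) ≤
      liminf (fun δ : ℝ => SAW.law D.carrier δ (a δ) (b δ)
        {γ : SAW.DomainSAW D.carrier δ (a δ) (b δ) |
          ∀ e ∈ γ.walk.edges, e ∈ (discreteDomainGraph D'.carrier δ).edgeSet}) (𝓝[>] (0 : ℝ)))
    {T : Set (CurveClass ℂ)} (hT : MeasurableSet T) :
    P D' T * P D (CurveClass.rangeSubset (closure D'.carrier)) =
      P D (T ∩ CurveClass.rangeSubset (closure D'.carrier)) := by
  haveI : IsProbabilityMeasure (P D') := hP.isProbabilityMeasure D'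
  haveI : IsProbabilityMeasure (P D) := hP.isProbabilityMeasure D
  generalize hc : Filter.liminf (fun δ : ℝ => SAW.law D.carrier δ (a δ) (b δ)
      {γ : SAW.DomainSAW D.carrier δ (a δ) (b δ) |
        ∀ e ∈ γ.walk.edges, e ∈ (discreteDomainGraph D'.carrier δ).edgeSet}) (𝓝[>] (0 : ℝ)) = c
    at *
  -- S2 (fed S1), both landed, at this pair and this endpoint approximation
  have hdom : ∀ S : Set (CurveClass ℂ), MeasurableSet S →
      c * P D' S ≤ P D (S ∩ CurveClass.rangeSubset (closure D'.carrier)) := by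
    intro S hS
    have := stub_domination stub_latticeRestriction P hP D D' hsub h0 h1 a b hab S hS
    rwa [hc] at this
  set μ := P D with hμ
  set ν := P D' with hν
  set R := CurveClass.rangeSubset (closure D'.carrier) with hR
  have hc_le : c ≤ μ R := by simpa [measure_univ] using hdom Set.univ MeasurableSet.univ
  have hc_eq : c = μ R := le_antisymm hc_le hN
  have hT1 : c * ν T ≤ μ (T ∩ R) := hdom T hT
  have hT2 : c * ν Tᶜ ≤ μ (Tᶜ ∩ R) := hdom Tᶜ hT.compl
  have hsumν : c * ν T + c * ν Tᶜ = c := by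
    rw [← mul_add, measure_add_measure_compl hT, measure_univ, mul_one]
  have hsumμ : μ (T ∩ R) + μ (Tᶜ ∩ R) = μ R := by
    rw [Set.inter_comm T R, Set.inter_comm Tᶜ R]
    exact measure_inter_add_sdiff₀ R hT.nullMeasurableSet
  have hfin : c * ν Tᶜ ≠ ∞ := ne_top_of_le_ne_top (measure_ne_top μ _) hT2
  have hsum : c * ν T + c * ν Tᶜ = μ (T ∩ R) + μ (Tᶜ ∩ R) := by rw [hsumν, hsumμ, hc_eq]
  have key : c * ν T = μ (T ∩ R) := eq_of_le_of_add_eq_add hT1 hT2 hsum hfin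
  rw [← hc_eq, mul_comm]
  exact key

/-- **The restriction identity for ONE pair from null touching for that pair**: if the limit law in `D` gives
zero mass to the curves staying in `cl D'` that touch `closure (D ∖ D')`, then
`P D'(T) · P D {γ ⊆ cl D'} = P D (T ∩ {γ ⊆ cl D'})` for every Borel `T` (an endpoint approximation of `D'` exists,
`SAW.exists_isEndpointApprox`; null touching ⇒ S3 for the pair, `noAvoidanceLoss_of_nullTouch`; then the localised
squeeze). [folklore] -/
theorem restriction_pair_of_nullTouch (hP : SAW.IsScalingLimitFamily P) {D D' : DobrushinDomain}
    (hsub : D'.carrier ⊆ D.carrier) (h0 : D'.pt 0 = D.pt 0) (h1 : D'.pt 1 = D.pt 1)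
    (hnull : P D (CurveClass.rangeSubset (closure D'.carrier) ∩
      {γ | (γ.range ∩ closure (D.carrier \ D'.carrier)).Nonempty}) = 0)
    {T : Set (CurveClass ℂ)} (hT : MeasurableSet T) :
    P D' T * P D (CurveClass.rangeSubset (closure D'.carrier)) =
      P D (T ∩ CurveClass.rangeSubset (closure D'.carrier)) := by
  obtain ⟨a, b, hab⟩ := SAW.exists_isEndpointApprox D'
  exact restriction_pair_of_noAvoidanceLoss hP hsub h0 h1 hab
    (noAvoidanceLoss_of_nullTouch hP hsub h0 h1 hab hnull) hT

/-! ### Touching events of a separated family are pairwise disjoint closed sets -/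

/-- The touching event is the complement of an avoidance event: `{range ∩ F ≠ ∅} = (rangeSubset Fᶜ)ᶜ`. [folklore] -/
theorem setOf_range_inter_nonempty_eq (F : Set ℂ) :
    {γ : CurveClass ℂ | (γ.range ∩ F).Nonempty} = (CurveClass.rangeSubset Fᶜ)ᶜ := by
  ext γ
  simp only [mem_setOf_eq, mem_compl_iff, CurveClass.mem_rangeSubset]
  constructor
  · rintro ⟨z, hz, hzF⟩ h
    exact h hz hzF
  · intro h
    by_contra h'
    exact h fun z hz hzF => h' ⟨z, hz, hzF⟩

/-- The event "stays in `cl Ω'` and touches the closed set `F`" is measurable (closed ∩ closed). [folklore] -/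
theorem measurableSet_rangeSubset_inter_touch (Ω' : Set ℂ) {F : Set ℂ} (hF : IsClosed F) :
    MeasurableSet (CurveClass.rangeSubset (closure Ω') ∩
      {γ : CurveClass ℂ | (γ.range ∩ F).Nonempty}) := by
  refine (CurveClass.measurableSet_rangeSubset isClosed_closure).inter ?_
  rw [setOf_range_inter_nonempty_eq]
  exact (isOpen_rangeSubset_compl hF).measurableSet.compl

/-- **Separated sub-domains have disjoint touching events.** If `cl E₁ ∩ cl (D ∖ E₂) = ∅`, no curve can stay in
`cl E₁` (and touch `cl (D ∖ E₁)`) while (staying in `cl E₂` and) touching `cl (D ∖ E₂)`. [folklore] -/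
theorem disjoint_touch_of_separated {D E₁ E₂ : Set ℂ}
    (hsep : closure E₁ ∩ closure (D \ E₂) = ∅) :
    Disjoint (CurveClass.rangeSubset (closure E₁) ∩
        {γ : CurveClass ℂ | (γ.range ∩ closure (D \ E₁)).Nonempty})
      (CurveClass.rangeSubset (closure E₂) ∩
        {γ : CurveClass ℂ | (γ.range ∩ closure (D \ E₂)).Nonempty}) := by
  rw [Set.disjoint_left]
  rintro γ ⟨h₁, -⟩ ⟨-, z, hz, hzF⟩
  have : z ∈ closure E₁ ∩ closure (D \ E₂) := ⟨(CurveClass.mem_rangeSubset.1 h₁) hz, hzF⟩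
  rw [hsep] at this
  exact this

/-- **Only countably many members of a separated family can be touched with positive probability.** For a finite
measure `μ` on curve classes, a set `D` and a family of sets `E i` that is SEPARATED — for `i ≠ j`,
`cl (E i) ∩ cl (D ∖ E j) = ∅` or `cl (E j) ∩ cl (D ∖ E i) = ∅` — the events "stays in `cl (E i)` and touches
`cl (D ∖ E i)`" are pairwise disjoint and measurable, so `{i | 0 < μ (…)}` is countable
(`Measure.countable_meas_pos_of_disjoint_iUnion`). [folklore] -/
theorem countable_setOf_touch_pos (μ : Measure (CurveClass ℂ)) [IsFiniteMeasure μ] (D : Set ℂ)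
    {ι : Type*} (E : ι → Set ℂ)
    (hsep : Pairwise fun i j => closure (E i) ∩ closure (D \ E j) = ∅ ∨
      closure (E j) ∩ closure (D \ E i) = ∅) :
    Set.Countable {i | 0 < μ (CurveClass.rangeSubset (closure (E i)) ∩
      {γ : CurveClass ℂ | (γ.range ∩ closure (D \ E i)).Nonempty})} := by
  refine Measure.countable_meas_pos_of_disjoint_iUnion
    (fun i => measurableSet_rangeSubset_inter_touch (E i) isClosed_closure) fun i j hij => ?_
  rcases hsep hij with h | h
  · exact disjoint_touch_of_separated h
  · exact (disjoint_touch_of_separated h).symm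

/-! ### Generic restriction -/

/-- **Registered stub `stub_restrictionOffCountable` — GENERIC RESTRICTION for a full SAW scaling limit.** For
every full scaling-limit family `P` of the critical `δℤ²` SAW, every Dobrushin domain `D` and every SEPARATED family
`E : ι → DobrushinDomain` of sub-domains of `D` with the same marked points (for `i ≠ j`,
`cl (E i) ∩ cl (D ∖ E j) = ∅` or the other way round — e.g. `D` minus closed discs of pairwise distinct radii about
a boundary point off `a, b`), there is a COUNTABLE set `S` of indices such that for every `i ∉ S` the two-sided
restriction identity holds: `P (E i) (T) · P D {γ ⊆ cl (E i)} = P D (T ∩ {γ ⊆ cl (E i)})` for all Borel `T`.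
Proof: `S := {i | P D (stay in cl (E i) ∧ touch cl (D ∖ E i)) > 0}` is countable (`countable_setOf_touch_pos`);
off `S` the pair is null-touching, hence restricted (`restriction_pair_of_nullTouch`). Lawler–Schramm–Werner 2004
§3.4.5 assert the identity for all `D'`; this is its unconditional "off a countable exceptional set" form.
[folklore] -/
theorem stub_restrictionOffCountable :
    ∀ P : ChordalFamily, SAW.IsScalingLimitFamily P →
      ∀ (D : DobrushinDomain) (ι : Type) (E : ι → DobrushinDomain),
        (∀ i, (E i).carrier ⊆ D.carrier) → (∀ i, (E i).pt 0 = D.pt 0) → (∀ i, (E i).pt 1 = D.pt 1) →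
        (Pairwise fun i j => closure (E i).carrier ∩ closure (D.carrier \ (E j).carrier) = ∅ ∨
          closure (E j).carrier ∩ closure (D.carrier \ (E i).carrier) = ∅) →
        ∃ S : Set ι, S.Countable ∧ ∀ i, i ∉ S → ∀ T : Set (CurveClass ℂ), MeasurableSet T →
          P (E i) T * P D (CurveClass.rangeSubset (closure (E i).carrier)) =
            P D (T ∩ CurveClass.rangeSubset (closure (E i).carrier)) := by
  intro P hP D ι E hsub h0 h1 hsep
  haveI : IsProbabilityMeasure (P D) := hP.isProbabilityMeasure D
  refine ⟨{i | 0 < P D (CurveClass.rangeSubset (closure (E i).carrier) ∩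
      {γ : CurveClass ℂ | (γ.range ∩ closure (D.carrier \ (E i).carrier)).Nonempty})},
    countable_setOf_touch_pos (P D) D.carrier (fun i => (E i).carrier) hsep, fun i hi T hT => ?_⟩
  have hnull : P D (CurveClass.rangeSubset (closure (E i).carrier) ∩
      {γ : CurveClass ℂ | (γ.range ∩ closure (D.carrier \ (E i).carrier)).Nonempty}) = 0 :=
    le_antisymm (not_lt.1 hi) bot_le
  exact restriction_pair_of_nullTouch hP (hsub i) (h0 i) (h1 i) hnull hT

end Summit.CriticalPhenomena.SAWScalingLimit.Theorems.RestrictionOfLimit.Birth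

end
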